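import Literature.NumberTheory.QuadraticFields.FundamentalDiscriminant
import Literature.NumberTheory.QuadraticFields.KroneckerCharacterFourProofs
import Literature.NumberTheory.QuadraticFields.JacobiCharacter
import Mathlib.NumberTheory.LSeries.PrimesInAP
import HarnessLib

/-!
# The Kronecker character of an imaginary quadratic field is odd (PROVED)

Topic `NumberTheory/QuadraticFields`; seat `rh-explicit-goldfeld-census-2` (GOLDFELD track of the
`rh-explicit` cell). Everything here is PROVED (one theorem, no definitions, no named facts).

For a quadratic field `K` with `d_K < 0`, the quadratic character `χ_K = (d_K/·)` satisfies
`χ_K(−1) = −1` (Cox, *Primes of the form x² + ny²*, §1.C, Lemma 1.14: the character `n ↦ (D/n)` has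
`χ(−1) = sign D`; Oesterlé 1985, p. 319: «`χ(−N) = 1`, ou ce qui revient au même `χ(N) = −1`»).
The tree states quadratic characters of `K` as Dirichlet characters `κ` mod `|d_K|` pinned by
their values at the primes (hypotheses `hoddp` / `htwo` of
`Quadratic.finprod_primesOver_eq_of_kronecker`, `Oesterle1985_proposition_2`,
`oesterle_coprime_5077`); `kroneckerChar_neg_one_of_discr_neg` derives `κ(−1) = −1` from the
odd-prime values alone: by Dirichlet's theorem (Mathlib `Nat.forall_exists_prime_gt_and_eq_mod`)
there is an odd prime `ℓ ≡ −1 (mod |d_K|)`, so `κ(−1) = κ(ℓ) = (d_K/ℓ)`; for `d_K ≡ 1 (mod 4)`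
this is `(ℓ/|d_K|) = (−1/|d_K|) = χ₄(|d_K|) = −1` (reciprocity, `|d_K| ≡ 3 (mod 4)`; the tree's
`jacobiSym_natAbs_eq_of_emod_four_eq_one`), and for `d_K = 4m` (`m ≡ 2, 3 (mod 4)`, the tree's
`Quadratic.discr_div_four_emod_four`) it is `(m/ℓ) = χ₄(ℓ)(|m|/ℓ) = −1` exactly as in the tree's
`apply_neg_one_of_forall_odd` (`KroneckerCharacterFourProofs.lean`). It discharges the hypothesis
`κ(−1) = −1` of `oesterle_coprime_5077` (`Oesterle5077Family.lean`).

## References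

* [Cox2013] D. A. Cox, *Primes of the form x² + ny²*, 2nd ed. (2013), §1.C Lemma 1.14.
* [Oesterle1985] J. Oesterlé, Sém. Bourbaki exp. 631, Astérisque 121–122 (1985), p. 319.
-/

noncomputable section

open scoped Classical NumberTheorySymbols

namespace Literature.NumberTheory.QuadraticFields

open Literature.NumberTheory.QuadraticFields.Quadratic

/-- **The quadratic character of an imaginary quadratic field is odd**: for `K` with
`[K:ℚ] = 2`, `d_K < 0`, and any Dirichlet character `κ` mod `d = |d_K|` with the Kronecker values
`(d_K/p)` at the odd primes `p`, `κ(−1) = −1` (Oesterlé 1985 p. 319: «`χ(−N) = 1`, ou ce qui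
revient au même `χ(N) = −1`»; Cox, Lemma 1.14). Proof: by Dirichlet's theorem pick an odd prime
`ℓ ≡ −1 (mod d)`; then `κ(−1) = κ(ℓ) = (d_K/ℓ)`, which is `(ℓ/d) = (−1/d) = −1` for odd
`d_K ≡ 1 (mod 4)` (reciprocity, `d ≡ 3 (mod 4)`), and `(m/ℓ) = χ₄(ℓ)(|m|/ℓ) = −1` for
`d_K = 4m`, `m ≡ 2, 3 (mod 4)`. [cite: Cox2013, §1.C Lemma 1.14] -/
theorem kroneckerChar_neg_one_of_discr_neg {K : Type*} [Field K] [NumberField K]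
    (h2 : Module.finrank ℚ K = 2) (hneg : NumberField.discr K < 0)
    (κ : DirichletCharacter ℂ (NumberField.discr K).natAbs)
    (hoddp : ∀ p : ℕ, p.Prime → p ≠ 2 → κ p = (jacobiSym (NumberField.discr K) p : ℂ)) :
    κ (-1) = -1 := by
  set D := NumberField.discr K with hDdef
  have hD0 : D ≠ 0 := NumberField.discr_ne_zero K
  have hd0 : D.natAbs ≠ 0 := Int.natAbs_ne_zero.mpr hD0
  haveI : NeZero D.natAbs := ⟨hd0⟩
  -- an odd prime `ℓ ≡ -1 (mod d)`
  obtain ⟨ℓ, hℓ2, hℓ, hℓmod⟩ :=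
    Nat.forall_exists_prime_gt_and_eq_mod (isUnit_one.neg : IsUnit (-1 : ZMod D.natAbs)) 2
  have hℓne : ℓ ≠ 2 := by omega
  have hℓodd : Odd ℓ := hℓ.odd_of_ne_two hℓne
  have hcong : (ℓ : ℤ) % (D.natAbs : ℕ) = (-1 : ℤ) % (D.natAbs : ℕ) := by
    refine (ZMod.intCast_eq_intCast_iff' (ℓ : ℤ) (-1) D.natAbs).mp ?_
    push_cast
    exact hℓmod
  have key : J(D | ℓ) = -1 := by
    rcases discr_emod_four h2 with h4 | h4
    · -- even discriminant `D = 4m`, `m ≡ 2, 3 (mod 4)`, `m < 0`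
      have h4dvd : (4 : ℤ) ∣ D := Int.dvd_of_emod_eq_zero h4
      have hm4 := discr_div_four_emod_four h2 h4dvd
      obtain ⟨m, hm⟩ := h4dvd
      have hDm : D / 4 = m := by omega
      rw [hDm] at hm4
      have hmneg : m < 0 := by omega
      set n := m.natAbs with hn
      have hmn : m = -(n : ℤ) := by omega
      have hn0 : 0 < n := by omega
      have hdn : D.natAbs = 4 * n := by omega
      have hcong' : (ℓ : ℤ) % ((4 * n : ℕ) : ℤ) = (-1 : ℤ) % ((4 * n : ℕ) : ℤ) := by
        rw [← hdn]; exact hcong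
      have hℓ4 : ℓ % 4 = 3 := by
        have h1 : (ℓ : ℤ) % 4 = (-1 : ℤ) % 4 := by
          have hk : (4 : ℤ) ∣ ((4 * n : ℕ) : ℤ) := ⟨n, by push_cast; ring⟩
          rw [← Int.emod_emod_of_dvd (ℓ : ℤ) hk, hcong', Int.emod_emod_of_dvd _ hk]
        omega
      have hgcd : (2 : ℤ).gcd ℓ = 1 := by
        rw [show (2 : ℤ) = ((2 : ℕ) : ℤ) from rfl, Int.gcd_natCast_natCast]
        exact (Nat.coprime_primes Nat.prime_two hℓ).mpr (Ne.symm hℓne)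
      rw [hm, jacobiSym.mul_left, show (4 : ℤ) = 2 ^ 2 by norm_num, jacobiSym.sq_one' hgcd,
        one_mul, hmn, jacobiSym.neg _ hℓodd, ZMod.χ₄_nat_three_mod_four hℓ4]
      suffices h : J((n : ℤ) | ℓ) = 1 by rw [h]; norm_num
      rcases hm4 with h42 | h43
      · -- `m ≡ 2 (mod 4)`: `n = 2 n₀`, `n₀` odd, `ℓ ≡ 7 (mod 8)`
        obtain ⟨n₀, hn₀⟩ : 2 ∣ n := by omega
        have hn₀odd : Odd n₀ := Nat.odd_iff.mpr (by omega)
        have hℓ8 : ℓ % 8 = 7 := by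
          have h1 : (ℓ : ℤ) % 8 = (-1 : ℤ) % 8 := by
            have hk : (8 : ℤ) ∣ ((4 * n : ℕ) : ℤ) := ⟨n₀, by rw [hn₀]; push_cast; ring⟩
            rw [← Int.emod_emod_of_dvd (ℓ : ℤ) hk, hcong', Int.emod_emod_of_dvd _ hk]
          omega
        rw [show (n : ℤ) = 2 * (n₀ : ℤ) by rw [hn₀]; push_cast; ring, jacobiSym.mul_left,
          jacobiSym.at_two hℓodd, (χ₈_nat_of_mod_eight (b := ℓ)).1 hℓ8, one_mul]
        refine jacobiSym_eq_one_of_mod_four_eq_three_of_emod_eq_neg_one hn₀odd hℓ4 ?_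
        have hk : (n₀ : ℤ) ∣ ((4 * n : ℕ) : ℤ) := ⟨8, by rw [hn₀]; push_cast; ring⟩
        rw [← Int.emod_emod_of_dvd (ℓ : ℤ) hk, hcong', Int.emod_emod_of_dvd _ hk]
      · -- `m ≡ 3 (mod 4)`: `n` odd
        have hnodd : Odd n := Nat.odd_iff.mpr (by omega)
        refine jacobiSym_eq_one_of_mod_four_eq_three_of_emod_eq_neg_one hnodd hℓ4 ?_
        have hk : (n : ℤ) ∣ ((4 * n : ℕ) : ℤ) := ⟨4, by push_cast; ring⟩
        rw [← Int.emod_emod_of_dvd (ℓ : ℤ) hk, hcong', Int.emod_emod_of_dvd _ hk]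
    · -- odd discriminant `D ≡ 1 (mod 4)`: `(D/ℓ) = (ℓ/d) = (-1/d) = χ₄(d) = -1`
      have hdodd : Odd D.natAbs := by
        rw [Int.natAbs_odd]
        exact Int.odd_iff.mpr (by omega)
      have hd4 : D.natAbs % 4 = 3 := by omega
      rw [← jacobiSym_natAbs_eq_of_emod_four_eq_one h4 hℓodd, jacobiSym_eq_χ₄_of_emod_eq hdodd hcong,
        ZMod.χ₄_nat_three_mod_four hd4]
  rw [← hℓmod, hoddp ℓ hℓ hℓne, key]
  norm_num

end Literature.NumberTheory.QuadraticFields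

end
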